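import Mathlib.RingTheory.DedekindDomain.AdicValuation
import Literature.NumberTheory.Automorphic.SymplecticGroupCartanDecomposition
import HarnessLib

/-!
# The Cartan decomposition of `Sp(J, K_v)` at every finite place `v` of a Dedekind domain
# (`Sp(J, K_v) = Sp(J, 𝒪_v) · diag(π^{a}; π^{-a}) · Sp(J, 𝒪_v)`, `π ∈ K` a global uniformiser)

Topic `NumberTheory/Automorphic`; namespace `Literature.NumberTheory.Automorphic.SymplecticCartan` (lane `lit-hodgefound`,
Track 2 foundations; seat `lit-hodgefound-p11`, generation 34, row g34-#4, file 4).  THEOREMS ONLY (D-0026): no definition,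
no named fact, no instance, no notation.  The instance of `SymplecticCartan.exists_cartan_decomposition` (file 3: any field
with `Valued K ℤᵐ⁰` and a uniformiser) at the `v`-adic completion `K_v = v.adicCompletion K` of the fraction field `K` of a
Dedekind domain `R`, `v : HeightOneSpectrum R` (in particular `R = 𝓞 F` of a number field), with the diagonal representative
written in a uniformiser `π ∈ K` of `v` (`v.valuation K π = exp (-1)`, Mathlib
`IsDedekindDomain.HeightOneSpectrum.valuation_exists_uniformizer`) and integrality stated as membership in
`v.adicCompletionIntegers K`.

## The print

[AndrianovZhuravlev1995] Ch. 3 §3, Lemma 3.6 and the «symplectic divisors» (held text `galaxy-panama-466270239588381`); the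
local Cartan decomposition `G(F_v) = K_v T K_v` for hyperspecial `K_v` is [Tits1979] §3.3.3; for `Sp` at the places of a
number field it is the «well known» input of [Kottwitz1992] §7, Lemma 7.4 (Case C).

## What is formalised

* `exists_cartan_decomposition_adicCompletion` — `R` Dedekind, `K = Frac R`, `v` a finite place, `π ∈ K` with
  `v(π) = exp (-1)`, `l` a finite index type: every `g ∈ Sp(J, K_v)` has `k₁ g k₂ = diag(π^{aᵢ}; π^{-aᵢ})` with
  `k₁, k₂ ∈ Sp(J, K_v)` whose entries and inverse entries lie in `𝒪_v = v.adicCompletionIntegers K`, `a : l → ℕ`.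
* `exists_cartan_decomposition_adicCompletion'` — the same with `∃ π ∈ K` (a global uniformiser always exists).
* `exists_eq_mul_diagonal_mul_adicCompletion` — product form `g = k₁ · diag(π^{a}; π^{-a}) · k₂`.

## References
* [AndrianovZhuravlev1995] A. N. Andrianov, V. G. Zhuravlev, *Modular Forms and Hecke Operators*, Transl. Math. Monogr. 145,
  AMS (1995), Ch. 3 §3, Lemma 3.6.
* [Tits1979] J. Tits, *Reductive groups over local fields*, Proc. Symp. Pure Math. 33.1 (1979), §3.3.3.
* [Kottwitz1992] R. E. Kottwitz, J. AMS 5 (1992), §7, Lemma 7.4.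
* [CasselsFrohlichANT1967] J. W. S. Cassels, A. Fröhlich (eds.), *Algebraic Number Theory* (1967), Ch. II §4 (uniformisers of
  the completions come from the global field).
-/

noncomputable section

open scoped Valued WithZero
open Matrix IsDedekindDomain

namespace Literature.NumberTheory.Automorphic.SymplecticCartan

variable {R : Type*} [CommRing R] [IsDedekindDomain R] {K : Type*} [Field K] [Algebra R K] [IsFractionRing R K]
  (v : HeightOneSpectrum R) {l : Type*} [Fintype l] [DecidableEq l]

/-- A uniformiser `π ∈ K` of `v` is a uniformiser of the completion `K_v`: `|π|_v = exp (-1)`.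
[cite: CasselsFrohlichANT1967, Ch. II §4] -/
theorem valued_coe_uniformizer {π : K} (hπ : v.valuation K π = WithZero.exp (-1 : ℤ)) :
    Valued.v (π : v.adicCompletion K) = WithZero.exp (-1 : ℤ) := by
  rw [HeightOneSpectrum.valuedAdicCompletion_eq_valuation', hπ]

/-- **Cartan decomposition of `Sp(J, K_v)` relative to `Sp(J, 𝒪_v)` at a finite place `v`, in a global uniformiser `π`.**
For `g ∈ Sp(J, K_v)` there are `k₁, k₂ ∈ Sp(J, K_v)` with all entries of `k₁, k₁⁻¹, k₂, k₂⁻¹` in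
`𝒪_v = v.adicCompletionIntegers K` and exponents `a : l → ℕ` with `k₁ g k₂ = diag(π^{aᵢ} (first block); π^{-aᵢ} (second))`.
[cite: AndrianovZhuravlev1995, Ch. 3 §3, Lemma 3.6; Tits1979, §3.3.3; Kottwitz1992, §7 Lemma 7.4] -/
theorem exists_cartan_decomposition_adicCompletion {π : K} (hπ : v.valuation K π = WithZero.exp (-1 : ℤ))
    (g : symplecticGroup l (v.adicCompletion K)) :
    ∃ (k₁ k₂ : symplecticGroup l (v.adicCompletion K)) (a : l → ℕ),
      (∀ i j, (k₁ : Matrix (l ⊕ l) (l ⊕ l) (v.adicCompletion K)) i j ∈ v.adicCompletionIntegers K) ∧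
      (∀ i j, ((k₁⁻¹ : symplecticGroup l (v.adicCompletion K)) : Matrix (l ⊕ l) (l ⊕ l) (v.adicCompletion K)) i j ∈
        v.adicCompletionIntegers K) ∧
      (∀ i j, (k₂ : Matrix (l ⊕ l) (l ⊕ l) (v.adicCompletion K)) i j ∈ v.adicCompletionIntegers K) ∧
      (∀ i j, ((k₂⁻¹ : symplecticGroup l (v.adicCompletion K)) : Matrix (l ⊕ l) (l ⊕ l) (v.adicCompletion K)) i j ∈
        v.adicCompletionIntegers K) ∧
      ((k₁ * g * k₂ : symplecticGroup l (v.adicCompletion K)) : Matrix (l ⊕ l) (l ⊕ l) (v.adicCompletion K)) =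
        Matrix.diagonal (Sum.elim (fun i => (π : v.adicCompletion K) ^ a i) (fun i => ((π : v.adicCompletion K) ^ a i)⁻¹)) := by
  obtain ⟨k₁, k₂, a, h1, h2, h3, h4, hT⟩ := exists_cartan_decomposition (valued_coe_uniformizer v hπ) g
  exact ⟨k₁, k₂, a, fun i j => (HeightOneSpectrum.mem_adicCompletionIntegers R K v).2 (h1 i j),
    fun i j => (HeightOneSpectrum.mem_adicCompletionIntegers R K v).2 (h2 i j),
    fun i j => (HeightOneSpectrum.mem_adicCompletionIntegers R K v).2 (h3 i j),
    fun i j => (HeightOneSpectrum.mem_adicCompletionIntegers R K v).2 (h4 i j), hT⟩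

/-- **Cartan decomposition of `Sp(J, K_v)` at every finite place** (with SOME global uniformiser `π ∈ K`, which exists by
`valuation_exists_uniformizer`). [cite: AndrianovZhuravlev1995, Ch. 3 §3, Lemma 3.6; Tits1979, §3.3.3] -/
theorem exists_cartan_decomposition_adicCompletion' (g : symplecticGroup l (v.adicCompletion K)) :
    ∃ (π : K) (k₁ k₂ : symplecticGroup l (v.adicCompletion K)) (a : l → ℕ),
      v.valuation K π = WithZero.exp (-1 : ℤ) ∧
      (∀ i j, (k₁ : Matrix (l ⊕ l) (l ⊕ l) (v.adicCompletion K)) i j ∈ v.adicCompletionIntegers K) ∧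
      (∀ i j, ((k₁⁻¹ : symplecticGroup l (v.adicCompletion K)) : Matrix (l ⊕ l) (l ⊕ l) (v.adicCompletion K)) i j ∈
        v.adicCompletionIntegers K) ∧
      (∀ i j, (k₂ : Matrix (l ⊕ l) (l ⊕ l) (v.adicCompletion K)) i j ∈ v.adicCompletionIntegers K) ∧
      (∀ i j, ((k₂⁻¹ : symplecticGroup l (v.adicCompletion K)) : Matrix (l ⊕ l) (l ⊕ l) (v.adicCompletion K)) i j ∈
        v.adicCompletionIntegers K) ∧
      ((k₁ * g * k₂ : symplecticGroup l (v.adicCompletion K)) : Matrix (l ⊕ l) (l ⊕ l) (v.adicCompletion K)) =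
        Matrix.diagonal (Sum.elim (fun i => (π : v.adicCompletion K) ^ a i) (fun i => ((π : v.adicCompletion K) ^ a i)⁻¹)) := by
  obtain ⟨π, hπ⟩ := HeightOneSpectrum.valuation_exists_uniformizer K v
  obtain ⟨k₁, k₂, a, h⟩ := exists_cartan_decomposition_adicCompletion v hπ g
  exact ⟨π, k₁, k₂, a, hπ, h⟩

/-- **Product form at a finite place**: `g = k₁ · diag(π^{a}; π^{-a}) · k₂` with `k₁, k₂ ∈ Sp(J, 𝒪_v)`.
[cite: AndrianovZhuravlev1995, Ch. 3 §3, Lemma 3.6; Tits1979, §3.3.3] -/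
theorem exists_eq_mul_diagonal_mul_adicCompletion {π : K} (hπ : v.valuation K π = WithZero.exp (-1 : ℤ))
    (g : symplecticGroup l (v.adicCompletion K)) :
    ∃ (k₁ k₂ : symplecticGroup l (v.adicCompletion K)) (a : l → ℕ),
      (∀ i j, (k₁ : Matrix (l ⊕ l) (l ⊕ l) (v.adicCompletion K)) i j ∈ v.adicCompletionIntegers K) ∧
      (∀ i j, ((k₁⁻¹ : symplecticGroup l (v.adicCompletion K)) : Matrix (l ⊕ l) (l ⊕ l) (v.adicCompletion K)) i j ∈
        v.adicCompletionIntegers K) ∧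
      (∀ i j, (k₂ : Matrix (l ⊕ l) (l ⊕ l) (v.adicCompletion K)) i j ∈ v.adicCompletionIntegers K) ∧
      (∀ i j, ((k₂⁻¹ : symplecticGroup l (v.adicCompletion K)) : Matrix (l ⊕ l) (l ⊕ l) (v.adicCompletion K)) i j ∈
        v.adicCompletionIntegers K) ∧
      (g : Matrix (l ⊕ l) (l ⊕ l) (v.adicCompletion K)) =
        (k₁ : Matrix _ _ (v.adicCompletion K)) *
          Matrix.diagonal (Sum.elim (fun i => (π : v.adicCompletion K) ^ a i) (fun i => ((π : v.adicCompletion K) ^ a i)⁻¹)) *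
          (k₂ : Matrix _ _ (v.adicCompletion K)) := by
  obtain ⟨k₁, k₂, a, h1, h2, h3, h4, hT⟩ := exists_eq_mul_diagonal_mul (valued_coe_uniformizer v hπ) g
  exact ⟨k₁, k₂, a, fun i j => (HeightOneSpectrum.mem_adicCompletionIntegers R K v).2 (h1 i j),
    fun i j => (HeightOneSpectrum.mem_adicCompletionIntegers R K v).2 (h2 i j),
    fun i j => (HeightOneSpectrum.mem_adicCompletionIntegers R K v).2 (h3 i j),
    fun i j => (HeightOneSpectrum.mem_adicCompletionIntegers R K v).2 (h4 i j), hT⟩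

end Literature.NumberTheory.Automorphic.SymplecticCartan

end
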